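import Summits.CriticalPhenomena.PercolationContinuityZ3.Theorems.PercNearOneGluingNoHeavyLowerTailThreePartitionCubeLanes

/-!
# Twisted three-partition positivity (★★) = (M⁺-3) on SIX letters: soundness of the checker, III — **the packed transport preserves
# up-set domination** (the invariant of `packedGreedy`)

Support file (cell `prim-sahi`, seat `prim-sahi-typer` gen 34; `--supports stmt-CriticalPhenomena-4575`).  Pure proofs plus bookkeeping definitions
(`CodeUp`, `Dom`, `LOWC`, `TOTC`, `GState`); no `sorry`, standard axioms.  The (4,3) invariant of typer gen 32 (`…SahiPair43LinkGreedy`) adapted to the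
cube checker: every entry of the balance array is a lane vector `BIAS + β_i(x)`, the balances are bounded (`-LOWC ≤ β`, `Σ β ≤ TOTC`, so lanes stay
`< 2^GB`), and — the point — for every lane `i` the balance `β_i` is DOMINATED ON CODE UP-SETS by the scalar profile of the pair of lane `i`
(`Dom`: `Σ_{x∈C} β_i(x) ≤ Σ_{x∈C} c_i(x)` for every up-closed set of codes `C`), because every pull moves a nonnegative amount from a code `w` down
to a code `y ⊆ w`.  `gstate_init` (from `packedProfile_getD` + `sprof_eq`), `gstate_pullStep`, `gstate_pullAll`, `gstate_packedGreedy`. [this work]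
-/

namespace Summit.CriticalPhenomena.PercolationContinuityZ3.Theorems.ThreePartition.Cube

open Finset SahiGridPattern.Pair43
open scoped BigOperators

/-! ### Code up-sets and domination -/

/-- `C` is an up-closed set of codes below `2^m`. [this work] -/
def CodeUp (m : ℕ) (C : Finset ℕ) : Prop := C ⊆ range (2 ^ m) ∧ ∀ y ∈ C, ∀ w < 2 ^ m, sub y w = true → w ∈ C

/-- `β` is dominated by `c` on every code up-set. [this work] -/
def Dom (m : ℕ) (c : ℕ → ℤ) (β : ℕ → ℤ) : Prop := ∀ C : Finset ℕ, CodeUp m C → ∑ x ∈ C, β x ≤ ∑ x ∈ C, c x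

/-- Domination is reflexive. [this work] -/
theorem dom_refl (m : ℕ) (c : ℕ → ℤ) : Dom m c c := fun _ _ => le_rfl

/-- **A downward transfer keeps domination**: moving `a ≥ 0` from `w` to `y ⊆ w` (both codes). [this work] -/
theorem dom_transfer {m : ℕ} {c β : ℕ → ℤ} (h : Dom m c β) {w y : ℕ} (hw : w < 2 ^ m) (hyw : sub y w = true) {a : ℤ} (ha : 0 ≤ a) :
    Dom m c (fun x => β x - (if x = w then a else 0) + (if x = y then a else 0)) := by
  intro C hC
  refine le_trans ?_ (h C hC)
  rw [Finset.sum_add_distrib, Finset.sum_sub_distrib, Finset.sum_ite_eq' C w, Finset.sum_ite_eq' C y]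
  by_cases hy : y ∈ C
  · have hwC : w ∈ C := hC.2 y hy w hw hyw
    rw [if_pos hy, if_pos hwC]; linarith
  · rw [if_neg hy]; split_ifs <;> linarith

/-! ### The invariant -/

/-- Lower bound of every balance. [this work] -/
def LOWC : ℤ := 192

/-- Upper bound of the total balance of a lane. [this work] -/
def TOTC : ℤ := 64 * 2 ^ 13

/-- The scalar profile of lane `i` at the twist `t`, as a function of the code. [this work] -/
def prof (m : ℕ) (U V t : ℕ) (x : ℕ) : ℤ := (profileArr (mkTabs m) U V t).getD x 0

/-- **The invariant of the packed greedy** (cube version). [this work] -/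
structure GState (m nb : ℕ) (fU fV : ℕ → ℕ) (t : ℕ) (u : Array ℕ) : Prop where
  size : u.size = 2 ^ m
  lanes : ∃ W : ℕ → ℕ → ℕ, (∀ x < 2 ^ m, u.getD x 0 = ofLanes nb (W x)) ∧
    ∀ i < nb, ∃ β : ℕ → ℤ, (∀ x < 2 ^ m, (W x i : ℤ) = BIAS + β x) ∧ (∀ x < 2 ^ m, -LOWC ≤ β x) ∧
      (∑ x ∈ range (2 ^ m), β x) ≤ TOTC ∧ Dom m (prof m (fU i) (fV i) t) β

/-- Consequence of the invariant: every balance is small. [this work] -/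
theorem lane_small' {m : ℕ} (hm : 2 ^ m ≤ 64) {β : ℕ → ℤ} (hlow : ∀ x < 2 ^ m, -LOWC ≤ β x) (htot : (∑ x ∈ range (2 ^ m), β x) ≤ TOTC)
    {x : ℕ} (hx : x < 2 ^ m) : β x ≤ TOTC + 63 * LOWC := by
  have hsplit := Finset.add_sum_erase (range (2 ^ m)) β (mem_range.2 hx)
  have hcard : ((range (2 ^ m)).erase x).card ≤ 63 := by rw [Finset.card_erase_of_mem (mem_range.2 hx)]; simp; omega
  have hrest : (((range (2 ^ m)).erase x).card : ℤ) * (-LOWC) ≤ ∑ z ∈ (range (2 ^ m)).erase x, β z := by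
    have h := Finset.card_nsmul_le_sum ((range (2 ^ m)).erase x) β (-LOWC) fun z hz => hlow z (mem_range.1 (Finset.mem_of_mem_erase hz))
    simpa using h
  have hc : (((range (2 ^ m)).erase x).card : ℤ) ≤ 63 := by exact_mod_cast hcard
  unfold LOWC at hrest ⊢
  nlinarith

/-- Lane values in a `GState` are `< 2^GB`. [this work] -/
theorem lane_lt_GB' {m : ℕ} (hm : 2 ^ m ≤ 64) {W : ℕ} {β : ℕ → ℤ} {x : ℕ} (hW : (W : ℤ) = BIAS + β x) (hlow : ∀ z < 2 ^ m, -LOWC ≤ β z)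
    (htot : (∑ z ∈ range (2 ^ m), β z) ≤ TOTC) (hx : x < 2 ^ m) : W < 2 ^ GB := by
  have h1 := lane_small' hm hlow htot hx
  unfold TOTC LOWC at h1; unfold BIAS at hW
  have : (W : ℤ) < 2 ^ 21 := by rw [hW]; norm_num at h1 ⊢; linarith
  have h2 : W < 2 ^ 21 := by exact_mod_cast this
  exact h2.trans_le pow21_le_GB

/-! ### The initial state -/

/-- `countBelow n p ≤ n`. [this work] -/
theorem countBelow_le (n : ℕ) (p : ℕ → Bool) : countBelow n p ≤ n := by
  induction n with
  | zero => simp [countBelow]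
  | succ n ih => unfold countBelow; split_ifs <;> omega

/-- The biased scalar profile is `BIAS − LOWC ≤ · ≤ BIAS + 2^13`... precisely: its parts are small. [this work] -/
theorem sprof_bounds {m : ℕ} (hm : 2 ^ m ≤ 64) (U V : ℕ) {t y : ℕ} (ht : t < 2 ^ m) (hy : y < 2 ^ m) :
    -LOWC ≤ prof m U V t y ∧ prof m U V t y ≤ 2 ^ 13 := by
  have hnp : (mkTabs m).np = 2 ^ m := mkTabs_np m
  set r := (2 ^ m - 1) ^^^ (y ^^^ t) with hr
  have hrlt : r < 2 ^ m := Nat.xor_lt_two_pow (Nat.sub_one_lt (Nat.pos_iff_ne_zero.1 (Nat.two_pow_pos m))) (Nat.xor_lt_two_pow hy ht)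
  set L := ((mkTabs m).subsL.getD r #[]).toList with hL
  have hLlen : L.length ≤ 64 := (subsL_length_le m r hrlt).trans hm
  unfold prof profileArr
  rw [getD_ofFn _ _ (by rw [hnp]; exact hy)]
  simp only [hnp]
  rw [← hr, ← Array.foldl_toList, ← Array.foldl_toList, ← Array.foldl_toList, ← Array.foldl_toList, ← hL,
    foldl_count, foldl_count, foldl_count, foldl_count]
  simp only [Nat.zero_add]
  have hb := List.length_filter_le (fun s => U.testBit (s ^^^ t)) L
  have hc := List.length_filter_le (fun s => V.testBit (s ^^^ t)) L
  have hd := List.length_filter_le (fun s => (U &&& V).testBit (s ^^^ t)) L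
  have hg := List.length_filter_le (fun s => U.testBit (s ^^^ t) && V.testBit ((r ^^^ s) ^^^ t)) L
  have hpc : (mkTabs m).pcT.getD r 0 ≤ m := by
    rw [mkTabs_pcT_getD m r hrlt]; exact countBelow_le _ _
  have hpow : 2 ^ (mkTabs m).pcT.getD r 0 ≤ 64 := (Nat.pow_le_pow_right (by norm_num) hpc).trans hm
  have hpow' : ((2 : ℤ) ^ (mkTabs m).pcT.getD r 0) ≤ 64 := by exact_mod_cast hpow
  have hpow1 : (1 : ℤ) ≤ (2 : ℤ) ^ (mkTabs m).pcT.getD r 0 := by exact_mod_cast Nat.one_le_two_pow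
  rw [Nat.shiftLeft_eq]
  unfold LOWC
  constructor
  · split_ifs <;> push_cast <;> omega
  · split_ifs <;> push_cast <;> omega

/-- **`packedProfile` satisfies the invariant.** [this work] -/
theorem gstate_init {m nb : ℕ} (hm : 2 ^ m ≤ 64) {fU fV : ℕ → ℕ} (hU : ∀ i < nb, fU i < 2 ^ 64) (hV : ∀ i < nb, fV i < 2 ^ 64)
    {t : ℕ} (ht : t < 2 ^ m) :
    GState m nb fU fV t (packedProfile (mkTabs m) (ones nb) (extractAll (mkTabs m) (ones nb) (ofLanes nb fU))
      (extractAll (mkTabs m) (ones nb) (ofLanes nb fV))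
      (Array.ofFn fun c : Fin (mkTabs m).np =>
        (extractAll (mkTabs m) (ones nb) (ofLanes nb fU)).getD c 0 &&& (extractAll (mkTabs m) (ones nb) (ofLanes nb fV)).getD c 0) t) := by
  refine ⟨by unfold packedProfile; simp [mkTabs_np], fun y i => sprof (mkTabs m) (fU i) (fV i) t y,
    fun x hx => packedProfile_getD hm hU hV ht hx, fun i hi => ?_⟩
  refine ⟨prof m (fU i) (fV i) t, fun x hx => sprof_eq m hm _ _ ht hx, fun x hx => (sprof_bounds hm _ _ ht hx).1, ?_, dom_refl _ _⟩
  have hb : ∀ x ∈ range (2 ^ m), prof m (fU i) (fV i) t x ≤ 2 ^ 13 := fun x hx => (sprof_bounds hm _ _ ht (mem_range.1 hx)).2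
  have := Finset.sum_le_card_nsmul (range (2 ^ m)) _ _ hb
  have hcard : ((range (2 ^ m)).card : ℤ) ≤ 64 := by simp; exact_mod_cast hm
  refine this.trans ?_
  rw [nsmul_eq_mul, Finset.card_range]
  unfold TOTC
  have : ((2 ^ m : ℕ) : ℤ) ≤ 64 := by exact_mod_cast hm
  nlinarith

/-! ### One pull step -/

/-- Members of `upL y` are strict supercodes of `y`. [this work] -/
theorem mem_upL {m y : ℕ} (hy : y < 2 ^ m) {w : ℕ} (hw : w ∈ ((mkTabs m).upL.getD y #[]).toList) : w < 2 ^ m ∧ w ≠ y ∧ sub y w = true := by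
  have h1 : (mkTabs m).upL = Array.ofFn (fun y : Fin (1 <<< m) =>
      ((((List.range (m + 1)).flatMap fun k => (List.range (1 <<< m)).filter fun x =>
          (Array.ofFn fun x : Fin (1 <<< m) => pc m x).getD x 0 == k)).filter fun w => sub y w && !(w == y.val)).toArray) := rfl
  have hy' : y < 1 <<< m := by rw [Nat.one_shiftLeft]; exact hy
  rw [h1, getD_ofFn _ _ hy', List.toList_toArray, List.mem_filter] at hw
  obtain ⟨hw1, hw2⟩ := hw
  rw [List.mem_flatMap] at hw1
  obtain ⟨k, _, hk⟩ := hw1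
  rw [List.mem_filter, List.mem_range, Nat.one_shiftLeft] at hk
  simp only [Bool.and_eq_true, Bool.not_eq_true', beq_eq_false_iff_ne, ne_eq] at hw2
  exact ⟨hk.1, hw2.2, hw2.1⟩

/-- Members of `descOrd` are codes. [this work] -/
theorem mem_descOrd {m y : ℕ} (hy : y ∈ (mkTabs m).descOrd.toList) : y < 2 ^ m := by
  have h1 : (mkTabs m).descOrd = (((List.range (m + 1)).reverse.flatMap fun k => (List.range (1 <<< m)).filter fun x =>
      (Array.ofFn fun x : Fin (1 <<< m) => pc m x).getD x 0 == k)).toArray := rfl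
  rw [h1, List.toList_toArray, List.mem_flatMap] at hy
  obtain ⟨k, _, hk⟩ := hy
  rw [List.mem_filter, List.mem_range, Nat.one_shiftLeft] at hk
  exact hk.1

/-- **One pull step preserves the invariant** and keeps the remaining need a lane vector with lanes `≤ BIAS`. [this work] -/
theorem gstate_pullStep {m nb : ℕ} (hm : 2 ^ m ≤ 64) {fU fV : ℕ → ℕ} {t : ℕ} {u : Array ℕ} (hs : GState m nb fU fV t u) {y w : ℕ}
    (hy : y < 2 ^ m) (hw : w < 2 ^ m) (hne : w ≠ y) (hle : sub y w = true) {N : ℕ → ℕ} (hN : ∀ i < nb, N i ≤ BIAS) :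
    GState m nb fU fV t (pullStep (ones nb) (ones nb <<< GB) (ones nb * BIAS) y (u, ofLanes nb N) w).1 ∧
      ∃ N' : ℕ → ℕ, (pullStep (ones nb) (ones nb <<< GB) (ones nb * BIAS) y (u, ofLanes nb N) w).2 = ofLanes nb N' ∧
        ∀ i < nb, N' i ≤ BIAS := by
  by_cases hz : (ofLanes nb N == 0) = true
  · -- the remaining need is `== 0`: nothing happens (`Pair43.pullStep_of_beq`; this file's `pullStep` is gen 31's, definitionally)
    have hp : pullStep (ones nb) (ones nb <<< GB) (ones nb * BIAS) y (u, ofLanes nb N) w = (u, ofLanes nb N) :=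
      SahiGridPattern.Pair43.pullStep_of_beq w hz
    rw [hp]; exact ⟨hs, N, rfl, hN⟩
  obtain ⟨hsize, W, hu, hl⟩ := hs
  have hNlt : ∀ i < nb, N i < 2 ^ GB := fun i hi => (hN i hi).trans_lt BIAS_lt_GB
  have hWw : ∀ i < nb, W w i < 2 ^ GB := fun i hi => by
    obtain ⟨β, hW, hlow, htot, _⟩ := hl i hi; exact lane_lt_GB' hm (hW w hw) hlow htot hw
  let tt : ℕ → ℕ := fun i => min (N i) (W w i - BIAS)
  have hhav : satsub (ones nb) (ones nb <<< GB) (u.getD w 0) (ones nb * BIAS) = ofLanes nb (fun i => W w i - BIAS) := by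
    rw [hu w hw, biasV_eq]; exact satsub_eq hWw (fun _ _ => BIAS_lt_GB)
  have htt : lmin (ones nb) (ones nb <<< GB) (ofLanes nb N) (ofLanes nb (fun i => W w i - BIAS)) = ofLanes nb tt :=
    lmin_eq hNlt (fun i hi => (Nat.sub_le _ _).trans_lt (hWw i hi))
  have htle1 : ∀ i < nb, tt i ≤ N i := fun i _ => Nat.min_le_left _ _
  have htle2 : ∀ i < nb, tt i ≤ W w i - BIAS := fun i _ => Nat.min_le_right _ _
  have hstep : pullStep (ones nb) (ones nb <<< GB) (ones nb * BIAS) y (u, ofLanes nb N) w =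
      (((u.setIfInBounds w (u.getD w 0 - ofLanes nb tt)).setIfInBounds y (u.getD y 0 + ofLanes nb tt)), ofLanes nb N - ofLanes nb tt) := by
    unfold pullStep; rw [if_neg hz]; simp only []; rw [hhav, htt]
  rw [hstep]
  simp only []
  have hwS : w < u.size := hsize ▸ hw
  have hyS : y < (u.setIfInBounds w (u.getD w 0 - ofLanes nb tt)).size := by simp [hsize, hy]
  have eW : u.getD w 0 - ofLanes nb tt = ofLanes nb (fun i => W w i - tt i) := by
    rw [hu w hw]; exact ofLanes_sub fun i hi => (htle2 i hi).trans (Nat.sub_le _ _)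
  have eY : u.getD y 0 + ofLanes nb tt = ofLanes nb (fun i => W y i + tt i) := by rw [hu y hy, ofLanes_add]
  let W' : ℕ → ℕ → ℕ := fun x => if x = y then (fun i => W y i + tt i) else if x = w then (fun i => W w i - tt i) else W x
  refine ⟨⟨by simp [hsize], W', fun x hx => ?_, fun i hi => ?_⟩, fun i => N i - tt i, ofLanes_sub htle1,
    fun i hi => (Nat.sub_le _ _).trans (hN i hi)⟩
  · rw [getD_setIfInBounds_nat _ hyS]
    by_cases hxy : y = x
    · rw [if_pos hxy, eY]; subst hxy; simp [W']
    · rw [if_neg hxy, getD_setIfInBounds_nat _ hwS]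
      by_cases hxw : w = x
      · rw [if_pos hxw, eW]; subst hxw; simp [W', Ne.symm hxy]
      · rw [if_neg hxw, hu x hx]; simp [W', Ne.symm hxy, Ne.symm hxw]
  · obtain ⟨β, hW, hlow, htot, hdom⟩ := hl i hi
    have htw : tt i ≤ W w i - BIAS := htle2 i hi
    have htw' : tt i ≤ W w i := htw.trans (Nat.sub_le _ _)
    have hβw : (W w i : ℤ) = BIAS + β w := hW w hw
    have ht_le : (tt i : ℤ) ≤ max (β w) 0 := by
      by_cases hp : BIAS ≤ W w i
      · have h1 : (tt i : ℤ) ≤ (W w i : ℤ) - BIAS := by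
          have := htw; zify [hp] at this; exact this
        have : (0 : ℤ) ≤ β w := by linarith [h1]
        rw [max_eq_left this]; linarith
      · have h0 : W w i - BIAS = 0 := Nat.sub_eq_zero_of_le (Nat.le_of_not_le hp)
        have : tt i = 0 := Nat.eq_zero_of_le_zero (h0 ▸ htw)
        rw [this]; push_cast; exact le_max_right _ _
    refine ⟨fun x => β x - (if x = w then (tt i : ℤ) else 0) + (if x = y then (tt i : ℤ) else 0), fun x hx => ?_, fun x hx => ?_, ?_,
      dom_transfer hdom hw hle (Int.natCast_nonneg (tt i))⟩
    · by_cases hxy : x = y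
      · subst hxy
        simp only [W', if_true, if_neg (Ne.symm hne)]
        push_cast; rw [hW x hx]; ring
      · by_cases hxw : x = w
        · subst hxw
          simp only [W', if_neg hxy, if_true]
          rw [Nat.cast_sub htw', hW x hx]; ring
        · simp only [W', if_neg hxy, if_neg hxw]; rw [hW x hx]; ring
    · dsimp only
      have hb := hlow x hx
      have ht0 : (0 : ℤ) ≤ tt i := Int.natCast_nonneg _
      by_cases hxw : x = w
      · subst hxw
        rw [if_pos rfl, if_neg hne]
        rcases le_or_gt 0 (β x) with hpos | hneg
        · rw [max_eq_left hpos] at ht_le; unfold LOWC; linarith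
        · rw [max_eq_right hneg.le] at ht_le; linarith
      · rw [if_neg hxw]
        by_cases hxy : x = y
        · rw [if_pos hxy]; linarith
        · rw [if_neg hxy]; linarith
    · rw [Finset.sum_add_distrib, Finset.sum_sub_distrib, Finset.sum_ite_eq' (range (2 ^ m)) w, Finset.sum_ite_eq' (range (2 ^ m)) y,
        if_pos (mem_range.2 hw), if_pos (mem_range.2 hy)]
      linarith

/-! ### All pulls of one point; the whole greedy -/

/-- **All pulls of one point preserve the invariant.** [this work] -/
theorem gstate_pullAll {m nb : ℕ} (hm : 2 ^ m ≤ 64) {fU fV : ℕ → ℕ} {t : ℕ} {u : Array ℕ} (hs : GState m nb fU fV t u) {y : ℕ}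
    (hy : y < 2 ^ m) : GState m nb fU fV t (pullAll (mkTabs m) (ones nb) (ones nb <<< GB) (ones nb * BIAS) u y) := by
  have hs' := hs
  obtain ⟨hsize, W, hu, hl⟩ := hs
  have hWy : ∀ i < nb, W y i < 2 ^ GB := fun i hi => by
    obtain ⟨β, hW, hlow, htot, _⟩ := hl i hi; exact lane_lt_GB' hm (hW y hy) hlow htot hy
  have hneed : satsub (ones nb) (ones nb <<< GB) (ones nb * BIAS) (u.getD y 0) = ofLanes nb (fun i => BIAS - W y i) := by
    rw [hu y hy, biasV_eq]; exact satsub_eq (fun _ _ => BIAS_lt_GB) hWy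
  unfold pullAll
  simp only []
  rw [hneed]
  split
  · exact hs'
  · rw [← Array.foldl_toList]
    have H := foldl_inv
      (fun st : Array ℕ × ℕ => GState m nb fU fV t st.1 ∧ ∃ N : ℕ → ℕ, st.2 = ofLanes nb N ∧ ∀ i < nb, N i ≤ BIAS)
      (pullStep (ones nb) (ones nb <<< GB) (ones nb * BIAS) y) ((mkTabs m).upL.getD y #[]).toList
      (fun w hw st hst => by
        obtain ⟨hwlt, hne, hle⟩ := mem_upL hy hw
        obtain ⟨st1, st2⟩ := st
        obtain ⟨hG, N, hN2, hNle⟩ := hst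
        simp only at hG hN2
        subst hN2
        exact gstate_pullStep hm hG hy hwlt hne hle hNle)
      (u, ofLanes nb fun i => BIAS - W y i) ⟨hs', _, rfl, fun i _ => Nat.sub_le _ _⟩
    exact H.1

/-- **The packed greedy preserves the invariant.** [this work] -/
theorem gstate_packedGreedy {m nb : ℕ} (hm : 2 ^ m ≤ 64) {fU fV : ℕ → ℕ} {t : ℕ} {u : Array ℕ} (hs : GState m nb fU fV t u) :
    GState m nb fU fV t (packedGreedy (mkTabs m) (ones nb) u) := by
  unfold packedGreedy
  rw [← Array.foldl_toList]
  exact foldl_inv (GState m nb fU fV t) _ _ (fun y hy s hs => gstate_pullAll hm hs (mem_descOrd hy)) u hs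

end Summit.CriticalPhenomena.PercolationContinuityZ3.Theorems.ThreePartition.Cube
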